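import Summits.KontsevichZagierPeriods.KontsevichZagierPeriods.Theses.CobordismMove
import Summits.KontsevichZagierPeriods.KontsevichZagierPeriods.Theorems.CobordismMoveCP2VolumeCharts

/-!
# Route CobordismMove — the anchor `vol(ℂP²) = π²/2` inside the Kontsevich–Zagier rules

Settles item stmt-KontsevichZagierPeriods-5570 (`CP2Volume`, support of route
KontsevichZagierPeriods/CobordismMove): with KZ-literal (rational) data,

  `2·[ℝ⁴, 1/(1+|x|²)³] − [ℝ², 1/((1+x₀²)(1+x₁²))] ∈ KZ.relations`

(`ω_FS²` on the affine chart of `ℂP²` is `(2/π²)·dV/(1+|z|²)³`; values `2·π²/2` and `π·π`).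
The whole argument runs in the formal period ring `P = FormalRep ⧸ relations`
(`KZRulesAssociator.lean`), where `[r] − [r'] ∈ relations ↔ ⟦r⟧ = ⟦r'⟧`:

* `[ℝ⁴, (1+|x|²)⁻³] ∼ [B₄, 1]` and `[ℝ, 1/(1+y²)] ∼ [(−1,1), (1−x²)^{−1/2}]` by ONE change of
  variables each, along the Cauchy chart `y ↦ y/√(1+|y|²)` of `ℝⁿ` onto the unit ball
  (`|det| = (1+|y|²)^{−(n+2)/2}`; companion file `CobordismMoveCP2VolumeCharts.lean`);
* `toFormalPeriod_cauchyRep₂`: `⟦[ℝ², 1/((1+y₀²)(1+y₁²))]⟧ = ⟦β(½,½)⟧²` (Fubini square, the chart,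
  and the symmetric Beta fold of `KZBallPeelingAux.lean`);
* `two_mul_toFormalPeriod_ball_four`: `2·⟦[B₄, 1]⟧ = ⟦β(½,½)⟧²`, by peeling the ball
  (`KZBallPeeling.lean`), the symmetric Beta folds, `[(−1,1), 1] ∼ [pt, 2]`, and three Beta
  translations `(a+b)β(a,b+1) ∼ bβ(a,b)` (`KZBetaChains.lean`) — NO appeal to Dirichlet's
  re-association (the hypothesis `hdir` of `KZBallVolume.lean` is not needed for `B₄`);
* `cp2Volume_proof : …Theses.CobordismMove.CP2Volume`.

Sources: M. Kontsevich, D. Zagier, *Periods* (2001), §1.1–1.2 (the rules; `π` as the area of the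
disc), §4.1 (the algebra of periods); J. Milnor, J. Stasheff, *Characteristic Classes* (1974),
§14 (`vol(ℂPⁿ) = πⁿ/n!` for the Fubini–Study form). Everything is proved; no `def`, no named fact.
-/

noncomputable section

open MeasureTheory Set
open Literature.NumberTheory.Transcendental Literature.NumberTheory.Transcendental.KZ
open Literature.ModelTheory.ExponentialFields (IsSemialgebraic isSemialgebraic_univ)
open MvPolynomial (aeval X C)

namespace Summit.KontsevichZagierPeriods.CobordismMove.CP2Volume

/-! ## `[ℝ², 1/((1+y₀²)(1+y₁²))]` and `β(½,½)²` -/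

/-- **`⟦[ℝ², 1/((1+y₀²)(1+y₁²))]⟧ = ⟦β(½,½)⟧²`** in the formal period ring, for representations
pinned as `r' = [ℝ², 1/((1+y₀²)(1+y₁²))]` and `H = β(½,½) = [(0,1), t^{−1/2}(1−t)^{−1/2}]`:
`r'` has the domain and integrand of the Fubini square of `L = [ℝ, 1/(1+y²)]`
(`exists_cauchyRep₁`); `L ∼ [(−1,1), (1−x²)^{−1/2}]` by the Cauchy chart of `ℝ¹`
(`of_sub_of_mem_relations_cauchy`, `n = 1`: `(1 − y²/(1+y²))^{−1/2} (1+y²)^{−3/2} = 1/(1+y²)`),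
and `[(−1,1), (1−x²)^{−1/2}] ∼ β(½,½)` is the symmetric Beta fold
(`KZ.BallPeeling.symmetricBeta_equivalent`, `γ = −1/2`). Value identity `π · π = B(½,½)²`.
[cite: KontsevichZagier2001, §1.2] -/
theorem toFormalPeriod_cauchyRep₂ (r' : IntegralRep 2) (H : IntegralRep 1)
    (hr'd : r'.domain = univ)
    (hr'i : EqOn r'.integrand (fun y => 1 / ((1 + (y 0) ^ 2) * (1 + (y 1) ^ 2))) r'.domain)
    (hHd : H.domain = {t | t 0 ∈ Set.Ioo (0:ℝ) 1})
    (hHi : EqOn H.integrand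
      (fun t => (t 0) ^ (((1 / 2 : ℚ) : ℝ) - 1) * (1 - t 0) ^ (((1 / 2 : ℚ) : ℝ) - 1)) H.domain) :
    toFormalPeriod (of r') = toFormalPeriod (of H) * toFormalPeriod (of H) := by
  obtain ⟨L, hLd, hLi⟩ := exists_cauchyRep₁
  obtain ⟨A, hAd, hAi⟩ := exists_arcsineRep
  -- `r' ∼ L × L`
  have e0 : (Fin.castAdd 1 (0 : Fin 1) : Fin 2) = 0 := rfl
  have e1 : (Fin.natAdd 1 (0 : Fin 1) : Fin 2) = 1 := rfl
  have h1 : Equivalent r' (L.prod L) := by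
    refine of_sub_of_mem_relations_of_eqOn ?_ fun z hz => ?_
    · ext z
      simp [IntegralRep.prodDomain, hLd, hr'd]
    · rw [hr'i hz, IntegralRep.prod_integrand_eq, IntegralRep.prodFun_apply, hLi]
      simp only [e0, e1]
      rw [one_div_mul_one_div]
  -- `L ∼ A` (Cauchy chart of `ℝ¹`)
  have h2 : Equivalent L A := by
    refine of_sub_of_mem_relations_cauchy L A hLd (hAd.trans BallPeeling.setOf_apply_mem_Ioo_eq_ball)
      fun y => ?_
    rw [hLi, hAi]
    simp only [Fin.sum_univ_one]
    have hu : (0:ℝ) < 1 + (y 0) ^ 2 := by positivity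
    have hg2 : ((√(1 + (y 0) ^ 2))⁻¹ * y 0) ^ 2 = (y 0) ^ 2 / (1 + (y 0) ^ 2) := by
      rw [mul_pow, inv_pow, Real.sq_sqrt hu.le]
      ring
    have h1u : 1 - (y 0) ^ 2 / (1 + (y 0) ^ 2) = (1 + (y 0) ^ 2)⁻¹ := by
      field_simp
      ring
    rw [hg2, h1u, Real.rpow_neg (inv_nonneg.2 hu.le), Real.inv_rpow hu.le, inv_inv,
      ← Real.sqrt_eq_rpow]
    have hs : √(1 + (y 0) ^ 2) ≠ 0 := (Real.sqrt_pos.2 hu).ne'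
    have hsq : (√(1 + (y 0) ^ 2)) ^ 2 = 1 + (y 0) ^ 2 := Real.sq_sqrt hu.le
    have hv : (√(1 + (y 0) ^ 2)) ^ 3 = (1 + (y 0) ^ 2) * √(1 + (y 0) ^ 2) := by
      calc (√(1 + (y 0) ^ 2)) ^ 3 = (√(1 + (y 0) ^ 2)) ^ 2 * √(1 + (y 0) ^ 2) := by ring
        _ = (1 + (y 0) ^ 2) * √(1 + (y 0) ^ 2) := by rw [hsq]
    rw [show (1:ℕ) + 2 = 3 from rfl, inv_pow, hv, one_div, eq_comm, mul_inv, mul_comm (1 + (y 0) ^ 2)⁻¹,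
      ← mul_assoc, mul_inv_cancel₀ hs, one_mul]
  -- `A ∼ H` (symmetric Beta fold, `γ = -1/2`)
  have h3 : Equivalent A H :=
    BallPeeling.symmetricBeta_equivalent (-(1 / 2 : ℝ)) A H hAd (fun x _ => by rw [hAi]) hHd
      (fun x hx => by rw [hHi hx]; norm_num)
  rw [h1.toFormalPeriod_eq, ← toFormalPeriod_of_mul_of, (h2.trans h3).toFormalPeriod_eq]

/-! ## `2·⟦[B₄, 1]⟧ = ⟦β(½,½)⟧²` -/

/-- **`2 · ⟦[B₄, 1]⟧ = ⟦β(½,½)⟧²`** in the formal period ring (`2 · vol B₄ = π²`), for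
representations pinned as `B = [B₄, 1]` and `H = β(½,½)`, WITHOUT Dirichlet's re-association:
peel `[B₄, 1] ∼ [B₂, 1−|z|²] × [B₂, 1]` (`peelTwo_equivalent`), square the discs
`[B₂, (1−|w|²)^e] ∼ [(−1,1), (1−x²)^{e+1/2}] × [(−1,1), (1−s²)^e]` (`discToSquare_equivalent`),
fold the four intervals onto `β(½, 5/2)`, `β(½, 2)`, `β(½, 3/2)`, `β(½, 1)`
(`symmetricBeta_equivalent_*`), evaluate `[(−1,1), 1] ∼ [pt, 2]` (`symInterval_one_equivalent`),
and use the Beta translations `2β(½,5/2) ∼ (3/2)β(½,3/2)`, `(3/2)β(½,2) ∼ β(½,1)`,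
`β(½,3/2) ∼ ½β(½,½)` (`KZ.betaTranslation_equivalent`, integration by parts inside the rules):
`2·(3π/8)(4/3)(π/2)·2 = π²`. [cite: KontsevichZagier2001, §1.2] -/
theorem two_mul_toFormalPeriod_ball_four (B : IntegralRep 4) (H : IntegralRep 1)
    (hBd : B.domain = {z | ∑ i, (z i) ^ 2 < 1}) (hBi : EqOn B.integrand (fun _ => 1) B.domain)
    (hHd : H.domain = {t | t 0 ∈ Set.Ioo (0:ℝ) 1})
    (hHi : EqOn H.integrand
      (fun t => (t 0) ^ (((1 / 2 : ℚ) : ℝ) - 1) * (1 - t 0) ^ (((1 / 2 : ℚ) : ℝ) - 1)) H.domain) :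
    2 * toFormalPeriod (of B) = toFormalPeriod (of H) * toFormalPeriod (of H) := by
  have hh : (0 : ℚ) < 1 / 2 := by norm_num
  -- auxiliary representations
  obtain ⟨B4, hB4d, hB4i⟩ := BallPeeling.exists_ballRep (2 * 1 + 2) 0
  obtain ⟨P2, hP2d, hP2i⟩ := BallPeeling.exists_ballRep (2 * 1) (0 + 1)
  obtain ⟨D0, hD0d, hD0i⟩ := BallPeeling.exists_ballRep 2 0
  obtain ⟨S, hSd, hSi⟩ := BallPeeling.exists_symIntervalRep_nat_add_half 0
  obtain ⟨T, hTd, hTi⟩ := BallPeeling.exists_symIntervalRep_nat_add_half 1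
  obtain ⟨I0, hI0d, hI0i⟩ := BallPeeling.exists_symIntervalRep_nat 0
  obtain ⟨I1, hI1d, hI1i⟩ := BallPeeling.exists_symIntervalRep_nat 1
  obtain ⟨H1, hH1d, hH1i⟩ := exists_betaRep' (1 / 2) 1 hh one_pos
  obtain ⟨H32, hH32d, hH32i⟩ := exists_betaRep' (1 / 2) (3 / 2) hh (by norm_num)
  obtain ⟨H2, hH2d, hH2i⟩ := exists_betaRep' (1 / 2) 2 hh (by norm_num)
  obtain ⟨H52, hH52d, hH52i⟩ := exists_betaRep' (1 / 2) (5 / 2) hh (by norm_num)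
  -- `B ∼ B4` (same pinned data)
  have hB : Equivalent B B4 :=
    of_sub_of_mem_relations_of_eqOn (by rw [hB4d, hBd]) fun z hz => by rw [hBi hz, hB4i]; simp
  -- peeling and squaring
  have hF2 : Equivalent B4 (P2.prod D0) :=
    BallPeeling.peelTwo_equivalent 1 0 B4 P2 D0 hB4d (fun z _ => by rw [hB4i]) hP2d
      (fun z _ => by rw [hP2i]) hD0d (fun w _ => by rw [hD0i])
  have hF3 : Equivalent D0 (S.prod I0) :=
    BallPeeling.discToSquare_equivalent 0 D0 S I0 hD0d (fun w _ => by rw [hD0i]) hSd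
      (fun x _ => by rw [hSi]) hI0d (fun x _ => by rw [hI0i])
  have hF4 : Equivalent P2 (T.prod I1) :=
    BallPeeling.discToSquare_equivalent 1 P2 T I1 hP2d (fun w _ => by rw [hP2i]) hTd
      (fun x _ => by rw [hTi]) hI1d (fun x _ => by rw [hI1i])
  -- the symmetric Beta folds
  have hS : Equivalent S H32 :=
    BallPeeling.symmetricBeta_equivalent_nat_add_half 0 S H32 hSd (fun x _ => by rw [hSi]) hH32d
      (fun x _ => by rw [hH32i]; dsimp only; congr 2; push_cast; ring)
  have hT : Equivalent T H52 :=
    BallPeeling.symmetricBeta_equivalent_nat_add_half 1 T H52 hTd (fun x _ => by rw [hTi]) hH52d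
      (fun x _ => by rw [hH52i]; dsimp only; congr 2; push_cast; ring)
  have hI1 : Equivalent I1 H2 :=
    BallPeeling.symmetricBeta_equivalent_nat 1 I1 H2 hI1d (fun x _ => by rw [hI1i]) hH2d
      (fun x _ => by rw [hH2i]; dsimp only; congr 2; push_cast; ring)
  have hI0 : Equivalent I0 H1 :=
    BallPeeling.symmetricBeta_equivalent_nat 0 I0 H1 hI0d (fun x _ => by rw [hI0i]) hH1d
      (fun x _ => by rw [hH1i]; dsimp only; congr 2; push_cast; ring)
  -- `[(−1,1), 1] ∼ [pt, 2]`
  have hI0' : Equivalent I0 (IntegralRep.unit.constMul ((2:ℕ):ℝ) (isAlgebraic_nat 2)) :=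
    symInterval_one_equivalent I0 hI0d (fun x _ => by rw [hI0i]; simp)
  have hc2 : toFormalPeriod (of (IntegralRep.unit.constMul ((2:ℕ):ℝ) (isAlgebraic_nat 2))) = 2 := by
    simpa using toFormalPeriod_of_unit_constMul_natCast 2 (isAlgebraic_nat 2)
  -- the Beta translations
  have ha12 : IsAlgebraic ℚ ((2:ℝ)⁻¹) := by exact_mod_cast (isAlgebraic_nat 2).inv
  have ha32 : IsAlgebraic ℚ (((3 / 2 : ℚ)) : ℝ) := by
    simpa using isAlgebraic_algebraMap (R := ℚ) (A := ℝ) (3 / 2 : ℚ)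
  have hF7 : Equivalent H32 (H.constMul ((2:ℝ)⁻¹) ha12) :=
    betaTranslation_equivalent (1 / 2) (1 / 2) hh hh H32 _ hH32d
      (fun x _ => by rw [hH32i]; dsimp only; push_cast; ring_nf)
      (by rw [IntegralRep.domain_constMul, hHd])
      (fun x hx => by
        rw [IntegralRep.integrand_constMul]
        dsimp only
        rw [hHi hx]
        push_cast
        ring_nf)
  have hF8 : Equivalent (H2.constMul _ ha32) H1 :=
    betaTranslation_equivalent (1 / 2) 1 hh one_pos _ H1 (by rw [IntegralRep.domain_constMul, hH2d])
      (fun x _ => by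
        rw [IntegralRep.integrand_constMul]
        dsimp only
        rw [hH2i]
        push_cast
        ring_nf)
      hH1d (fun x _ => by rw [hH1i]; push_cast; ring_nf)
  have hF9 : Equivalent (H52.constMul ((2:ℕ):ℝ) (isAlgebraic_nat 2)) (H32.constMul _ ha32) :=
    betaTranslation_equivalent (1 / 2) (3 / 2) hh (by norm_num) _ _
      (by rw [IntegralRep.domain_constMul, hH52d])
      (fun x _ => by
        rw [IntegralRep.integrand_constMul]
        dsimp only
        rw [hH52i]
        push_cast
        ring_nf)
      (by rw [IntegralRep.domain_constMul, hH32d])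
      (fun x _ => by
        rw [IntegralRep.integrand_constMul]
        dsimp only
        rw [hH32i])
  -- in the formal period ring
  have E1 := hB.toFormalPeriod_eq
  have E2 := hF2.toFormalPeriod_eq
  have E3 := hF3.toFormalPeriod_eq
  have E4 := hF4.toFormalPeriod_eq
  rw [← toFormalPeriod_of_mul_of] at E2 E3 E4
  have Es := hS.toFormalPeriod_eq
  have Et := hT.toFormalPeriod_eq
  have Ei1 := hI1.toFormalPeriod_eq
  have Ei0 := hI0.toFormalPeriod_eq
  have E6 : toFormalPeriod (of I0) = 2 := by rw [hI0'.toFormalPeriod_eq, hc2]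
  have E7 : toFormalPeriod (of H32) =
      toFormalPeriod (of (IntegralRep.unit.constMul ((2:ℝ)⁻¹) ha12)) * toFormalPeriod (of H) := by
    rw [hF7.toFormalPeriod_eq, toFormalPeriod_of_constMul]
  have E8 : toFormalPeriod (of (IntegralRep.unit.constMul _ ha32)) * toFormalPeriod (of H2) =
      toFormalPeriod (of H1) := by
    rw [← toFormalPeriod_of_constMul]
    exact hF8.toFormalPeriod_eq
  have E9 : 2 * toFormalPeriod (of H52) =
      toFormalPeriod (of (IntegralRep.unit.constMul _ ha32)) * toFormalPeriod (of H32) := by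
    rw [← hc2, ← toFormalPeriod_of_constMul, ← toFormalPeriod_of_constMul]
    exact hF9.toFormalPeriod_eq
  have E10 := two_mul_toFormalPeriod_unit_constMul_half ha12
  set b := toFormalPeriod (of B)
  set b4 := toFormalPeriod (of B4)
  set p2 := toFormalPeriod (of P2)
  set d0 := toFormalPeriod (of D0)
  set s := toFormalPeriod (of S)
  set t := toFormalPeriod (of T)
  set i0 := toFormalPeriod (of I0)
  set i1 := toFormalPeriod (of I1)
  set h1 := toFormalPeriod (of H1)
  set h32 := toFormalPeriod (of H32)
  set h2 := toFormalPeriod (of H2)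
  set h52 := toFormalPeriod (of H52)
  set h := toFormalPeriod (of H)
  set c12 := toFormalPeriod (of (IntegralRep.unit.constMul ((2:ℝ)⁻¹) ha12))
  set c32 := toFormalPeriod (of (IntegralRep.unit.constMul _ ha32))
  linear_combination 2 * E1 + 2 * E2 + 2 * d0 * E4 + 2 * t * i1 * E3 + 2 * i1 * s * i0 * Et +
    i1 * s * i0 * E9 + c32 * h32 * s * i0 * Ei1 + h32 * s * i0 * E8 + h1 * h32 * i0 * Es -
    h32 ^ 2 * i0 * Ei0 + (i0 + 2) * h32 ^ 2 * E6 + 4 * (h32 + c12 * h) * E7 +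
    (2 * c12 + 1) * h ^ 2 * E10

/-! ## The item -/

/-- Settles item stmt-KontsevichZagierPeriods-5570 (`CP2Volume`, route CobordismMove): the
anchor `vol(ℂP²) = π²/2` as a chain with KZ-literal data,
`2·[ℝ⁴, 1/(1+|x|²)³] − [ℝ², 1/((1+x₀²)(1+x₁²))] ∈ KZ.relations`.
Chain: `[ℝ⁴, (1+|x|²)⁻³] ∼ [B₄, 1]` by ONE change of variables along the Cauchy chart
`x ↦ x/√(1+|x|²)` (`|det| = (1+|x|²)⁻³`, `of_sub_of_mem_relations_cauchy`), then
`2·⟦[B₄, 1]⟧ = ⟦β(½,½)⟧²` (`two_mul_toFormalPeriod_ball_four`) and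
`⟦[ℝ², 1/((1+x₀²)(1+x₁²))]⟧ = ⟦β(½,½)⟧²` (`toFormalPeriod_cauchyRep₂`) in the formal period ring
`P = FormalRep ⧸ relations`. Values `2·π²/2 = π²`. [cite: KontsevichZagier2001, §1.2] -/
theorem cp2Volume_proof :
    Summit.KontsevichZagierPeriods.KontsevichZagierPeriods.Theses.CobordismMove.CP2Volume := by
  intro r r' hrd hri hr'd hr'i
  have hh : (0 : ℚ) < 1 / 2 := by norm_num
  obtain ⟨H, hHd, hHi⟩ := exists_betaRep' (1 / 2) (1 / 2) hh hh
  obtain ⟨B, hBd, hBi⟩ := BallPeeling.exists_ballRep 4 0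
  -- `r ∼ [B₄, 1]` along the Cauchy chart of `ℝ⁴`
  have h1 : Equivalent r B := by
    refine of_sub_of_mem_relations_cauchy r B hrd hBd fun y => ?_
    rw [hri (by rw [hrd]; exact mem_univ y), hBi]
    dsimp only
    have hu : (0:ℝ) < 1 + ∑ j, (y j) ^ 2 := by positivity
    rw [pow_zero, one_mul, show (4:ℕ) + 2 = 2 * 3 from rfl, pow_mul, inv_pow, Real.sq_sqrt hu.le,
      inv_pow, one_div]
  have e1 : 2 * toFormalPeriod (of B) = toFormalPeriod (of H) * toFormalPeriod (of H) :=
    two_mul_toFormalPeriod_ball_four B H hBd (fun z _ => by rw [hBi]; simp) hHd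
      (fun t _ => by rw [hHi])
  have e2 : toFormalPeriod (of r') = toFormalPeriod (of H) * toFormalPeriod (of H) :=
    toFormalPeriod_cauchyRep₂ r' H hr'd hr'i hHd (fun t _ => by rw [hHi])
  apply toFormalPeriod_eq_zero_iff.mp
  rw [map_sub, map_nsmul, h1.toFormalPeriod_eq, nsmul_eq_mul, Nat.cast_ofNat, e1, ← e2, sub_self]

end Summit.KontsevichZagierPeriods.CobordismMove.CP2Volume

end
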